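import Summits.QuantumFields.BalabanUV.Beta.D1BFx.SliceTransferModel

/-!
# T-TEL (telescoping identity) line, helper 3 — THE CALCULUS LAYER: along `C²` background curves the response and the effective form satisfy the
# LEIBNIZ RELATIONS (R1), (R2) that helper 2 (`BalabanUVNodesK2D1TelSchurJets`) consumes

Helper for crux K2⁷ `EndpointGivenBR13SepCoPH` = stmt-QuantumFields-20543 (route `BalabanUVNodes`), seat `d1-tel-1` gen 0.  Helper 2 proved, by pure algebra,
that the jets `(S₀, S₁, S₂)` of the one-step effective form `S = A + B·W` (`D·W = −C`) are the two-leg dressings of the jets of the full block form by the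
FROZEN responses, minus (order 2) a bubble of dressed first-order vertices — from the Leibniz relations (R1) `D₀W₁ + D₁W₀ = −C₁`, (R2)
`D₀W₂ + 2·D₁W₁ + D₂W₀ = −C₂` ALONE.  This file supplies those relations for honest `C²` matrix CURVES in the tree's curve convention
(`ℝ → ι → κ → ℝ` read through `Matrix.of`, derivatives by `HasDerivAt`, as in `D1BFx.LogDetSecondVariation` ∕ `SliceTransferModel` ∕ `FP/NestedStepLaw*`):
if `D`, `W`, `C` are differentiable near `t` with first-jet curves `D₁, W₁, C₁`, these have derivatives `D₂, W₂, C₂` at `t`, and `D·W + C = 0` holds near `t`,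
then (R1) holds NEAR `t` (`leibniz_first_of_curves`) and (R2) holds AT `t` (`leibniz_second_of_curves`) — product rule (`SliceTransferModel.hasDerivAt_matMul`)
and uniqueness of derivatives, nothing else.  With `BalabanUVNodesK2D1TelSchurQuotient.schur_quotient_pointwise` (two-stage = one-shot effective form AS
FUNCTIONS of the background) the jets of both sides are then literally the same derivatives: the quadratic jets telescope.  0 `def`, 0 `sorry`; [folklore].

HONEST FRAMING.  Finite-dimensional calculus; nothing of Bałaban's kernels is asserted; the kernel-level dictionary (S3) of
`Cruxes/EndpointGivenBR13SepCoPH/D1TelSignatures.lean` is OPEN; `D1Tel`, K2⁷, `BetaPertH` NOT proved; NOT continuum, NOT OS, NOT Clay; the Yang–Mills mass gap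
is NOT proved.
-/

noncomputable section

namespace Summit.QuantumFields.YangMills.Theorems.BalabanUVNodesK2D1TelSchurJetsCurves

open Matrix Filter
open scoped Topology
open Summit.QuantumFields.BalabanUV.Beta.D1BFx.SliceTransferModel (hasDerivAt_matMul)

variable {α δ : Type*} [Fintype α] [Fintype δ]

/-- [folklore] **(R1) ALONG CURVES**: if `D`, `W`, `C` are differentiable near `t` (first-jet curves `D₁, W₁, C₁`) and `D·W + C = 0` near `t`, then
`D₁·W + D·W₁ + C₁ = 0` NEAR `t` (product rule + uniqueness of the derivative, at every point of the neighbourhood). -/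
theorem leibniz_first_of_curves {D D₁ : ℝ → δ → δ → ℝ} {W W₁ C C₁ : ℝ → δ → α → ℝ} {t : ℝ}
    (hD : ∀ᶠ u in 𝓝 t, HasDerivAt D (D₁ u) u) (hW : ∀ᶠ u in 𝓝 t, HasDerivAt W (W₁ u) u) (hC : ∀ᶠ u in 𝓝 t, HasDerivAt C (C₁ u) u)
    (hrel : ∀ᶠ u in 𝓝 t, Matrix.of (D u) * Matrix.of (W u) + Matrix.of (C u) = 0) :
    ∀ᶠ u in 𝓝 t, Matrix.of (D₁ u) * Matrix.of (W u) + Matrix.of (D u) * Matrix.of (W₁ u) + Matrix.of (C₁ u) = 0 := by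
  filter_upwards [hD, hW, hC, hrel.eventually_nhds] with u huD huW huC hrelu
  have hD' : HasDerivAt D (Matrix.of.symm (Matrix.of (D₁ u))) u := huD
  have hW' : HasDerivAt W (Matrix.of.symm (Matrix.of (W₁ u))) u := huW
  have h1 := (hasDerivAt_matMul hD' hW').add huC
  have heq : (fun v => Matrix.of.symm (Matrix.of (D v) * Matrix.of (W v)) + C v) =ᶠ[𝓝 u] (fun _ => (0 : δ → α → ℝ)) := by
    filter_upwards [hrelu] with v hv
    exact hv
  have h2 : HasDerivAt (fun v => Matrix.of.symm (Matrix.of (D v) * Matrix.of (W v)) + C v) (0 : δ → α → ℝ) u :=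
    (hasDerivAt_const u (0 : δ → α → ℝ)).congr_of_eventuallyEq heq
  exact h1.unique h2

/-- [folklore] **(R2) ALONG CURVES**: if moreover the first-jet curves `D₁, W₁, C₁` have derivatives `D₂, W₂, C₂` at `t`, then
`D₂·W₀ + 2·D₁W₁ + D₀·W₂ + C₂ = 0` AT `t` (`D₀ = D(t)`, …) — differentiate (R1) once more at `t`. -/
theorem leibniz_second_of_curves {D D₁ : ℝ → δ → δ → ℝ} {W W₁ C C₁ : ℝ → δ → α → ℝ} {D₂ : Matrix δ δ ℝ} {W₂ C₂ : Matrix δ α ℝ} {t : ℝ}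
    (hD : ∀ᶠ u in 𝓝 t, HasDerivAt D (D₁ u) u) (hW : ∀ᶠ u in 𝓝 t, HasDerivAt W (W₁ u) u) (hC : ∀ᶠ u in 𝓝 t, HasDerivAt C (C₁ u) u)
    (hD₁ : HasDerivAt D₁ (Matrix.of.symm D₂) t) (hW₁ : HasDerivAt W₁ (Matrix.of.symm W₂) t) (hC₁ : HasDerivAt C₁ (Matrix.of.symm C₂) t)
    (hrel : ∀ᶠ u in 𝓝 t, Matrix.of (D u) * Matrix.of (W u) + Matrix.of (C u) = 0) :
    D₂ * Matrix.of (W t) + 2 • (Matrix.of (D₁ t) * Matrix.of (W₁ t)) + Matrix.of (D t) * W₂ + C₂ = 0 := by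
  have hfirst := leibniz_first_of_curves hD hW hC hrel
  have hD' : HasDerivAt D (Matrix.of.symm (Matrix.of (D₁ t))) t := hD.self_of_nhds
  have hW' : HasDerivAt W (Matrix.of.symm (Matrix.of (W₁ t))) t := hW.self_of_nhds
  -- the two products of (R1) as curves, differentiated at `t`, plus `C₁`
  have ha := hasDerivAt_matMul hD₁ hW'
  have hb := hasDerivAt_matMul hD' hW₁
  have hsum := (ha.add hb).add hC₁
  have heq : (fun v => Matrix.of.symm (Matrix.of (D₁ v) * Matrix.of (W v)) + Matrix.of.symm (Matrix.of (D v) * Matrix.of (W₁ v)) + C₁ v)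
      =ᶠ[𝓝 t] (fun _ => (0 : δ → α → ℝ)) := by
    filter_upwards [hfirst] with v hv
    exact hv
  have h2 : HasDerivAt (fun v => Matrix.of.symm (Matrix.of (D₁ v) * Matrix.of (W v)) + Matrix.of.symm (Matrix.of (D v) * Matrix.of (W₁ v)) + C₁ v)
      (0 : δ → α → ℝ) t := (hasDerivAt_const t (0 : δ → α → ℝ)).congr_of_eventuallyEq heq
  have h3 : D₂ * Matrix.of (W t) + Matrix.of (D₁ t) * Matrix.of (W₁ t) + (Matrix.of (D₁ t) * Matrix.of (W₁ t) + Matrix.of (D t) * W₂) + C₂ = 0 :=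
    hsum.unique h2
  rw [← h3, two_smul]
  abel

omit [Fintype α] [Fintype δ] in
/-- [folklore] The relations in helper 2's letters: `X + Y + Z = 0 ↔ Y + X = −Z` (so (R1)∕(R2) above read `D₀W₁ + D₁W₀ = −C₁`,
`D₀W₂ + 2·D₁W₁ + D₂W₀ = −C₂` after commuting the summands). -/
theorem add_add_eq_zero_iff (X Y Z : Matrix δ α ℝ) : X + Y + Z = 0 ↔ Y + X = -Z := by
  constructor
  · intro h
    rw [add_comm Y X]
    exact eq_neg_of_add_eq_zero_left h
  · intro h
    rw [add_comm X Y, h, neg_add_cancel]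

end Summit.QuantumFields.YangMills.Theorems.BalabanUVNodesK2D1TelSchurJetsCurves
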